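import Summits.QuantumFields.YangMills.Theorems.UnitScaleTiltProp7SliceBoundOneStepT3
import Summits.QuantumFields.YangMills.Theorems.UnitScaleTiltProp7DefectTelescopeMemberT3
import Summits.QuantumFields.YangMills.Theorems.UnitScaleTiltProp7A6cCertificateOfSliceRow
import Summits.QuantumFields.YangMills.Theorems.UnitScaleTiltProp7OneStepDefectERowT3
import HarnessLib

/-!
# `UnitScaleTiltProp7SliceBoundOneStepMemberT3` — (I3′) PLAN B, FILE P4-E «THE MEMBER KNIT»: FILE B′'s `ℓ²` slice row `hT` — hence px13's (hv) and the A6ᶜ certificate at the flat member —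
# from the ONE displayed one-step defect row (E-ROW), with `A′ = C(L, K_E)∕ℓ`, K-FREE
(route `UnitScaleTilt`, crux K1 «MinimiserStabilityRegPr» stmt-QuantumFields-19200; route-R E′ (A′)-comb; ★★OWNER RULING №18 (2); PLAN B (px22 ac2baf06, adopted by w4 g8 05:54:26Z): P1 w4 ✓`Prop7GradBlindLocalCurlBound`
· P2 px21 ✓`Prop7OneStepDefect` · P3 px22 ✓`Prop7DefectTelescope`∕✓`Prop7DefectTelescopeMember` · P4 px6 ✓`Prop7SliceBoundBookkeeping`∕✓`Prop7OneStepL2Bounds`∕✓`Prop7SliceBoundOneStep` + THIS FILE; def-free,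
count-neutral).  Cell `ym3-torus` (HUMAN RULING D-0037, YM ladder rung R3 — YM₃ on T³ is a rung, not d = 4, not infinite volume, not a mass gap, not Clay), width seat `ym3-torus-px6` (gen 6).

THE PRINT.  [Balaban1985BackgroundPropagators] Thm 3.11 p. 416 at the flat member ⟸ COMB-FLAT COERCIVITY ⟸ (I3′) (px13 ✓`coercive_laplaceAc_one_of_sliceBound_basePt`) ⟸ the `ℓ²` row `hT` (w4 FILE B′
✓`Prop7SliceRowOfSqBound.sliceBound_basePt_of_sqBound`).  Here `hT` is DERIVED: the five PLAN B families `Q G T′ A Φ` are built by `Nat.rec` on the member's tower `F.P K` (so the filed theorem displays NO family),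
px22's ✓`defect_eq_A_add_grad` identifies `Q^{tw}_k(1)X′ − Q^{twS}_k(1)X` with `A_k X′ + dΦ_k X′`, w4's ✓`defect_toL2_apply` supplies the factor `η = L^{−(K−n)}`, px6's ✓`sum_norm_sq_defect_le_of_eRow` bounds
`Σ‖A_k + dΦ_k‖² ≤ Cdef·L^{K−n}·Σ‖curl X′‖²`, (B6) removes the translate, and the `L2Operator`∕entry comparison (P4-C §0) reads both sides in FILE B′'s entrywise letters: `A′ = 4·Cdef∕L^{K−n}`.
WHAT IS PROVED (sorry-free, no definition): ★★★`hT_holds` ∕ ★★★`hN06_at_one` — UNCONDITIONAL (the E-ROW discharged by px6 ✓`Prop7OneStepDefectERow.eRow_tower`); ★★★`hT_of_eRow (F) (h : n ≤ K) (hKE) (hE) : ∀ X, Σ_c Σ_{ii′}‖toL2B⁻¹(Qkc 1 (toL2 X′) − Qk 1 (toL2 X)) c i i′‖² ≤ (4·Cdef(F.L,K_E)∕F.L^{K−n})·Σ_pΣ_{ii′}‖curl 1 X p i i′‖²`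
— FILE B′'s `hT` TOKEN FOR TOKEN; ★★★`sliceBound_basePt_of_eRow` — px13's (hv) with `ρ = a₀·4·Cdef` (K-FREE); ★★★`hN06_at_one_of_eRow` — S27ᴸ∕S31ᴸ `hN06`'s conclusion AT `W := 1` (the A6ᶜ certificate) MODULO THE
E-ROW ALONE, via px6 ✓`hN06_at_one_of_sqBound`.  The ONE displayed hypothesis: (E-ROW) `∀ j < K−n, ∀ Y e, (∀ c, e c = linAvg Y c − γ_j Y c) → Σ_c‖e c‖² ≤ K_E·Σ_p‖curl 1 Y p‖²` on the tower `F.P K`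
(P4-D: w4 P1 ✓`normSq_le_of_gradBlind_local` ∘ px21's support row ∘ the box count `≤ 81`, w4 g9 06:41:25Z).
HONEST FRAMING.  A by-name knit; the E-ROW is displayed, not proved; nothing of N06 at curved `W`, HESS, E′, EX or the crux K1 is proved or claimed.  Rung R3, not Clay; YM gap NOT proved.
`--supports stmt-QuantumFields-19200 --as helper`.
References: T. Bałaban, CMP 99 (1985) 389–434 [Balaban1985BackgroundPropagators] ((3.14) p.393, Thm 3.11 p.416, (3.26)–(3.27) p.395); CMP 98 (1985) 17–51 [Balaban1985Averaging] ((124)–(127) pp.36–37);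
CMP 95 (1984) 17–40 [Balaban1984PropagatorsI] ((1.18) p.20, Prop. 1.1 (1.90) p.33); CMP 102 (1985) 277–309 [Balaban1985Variational] ((44)–(47) p.285).
-/

noncomputable section
open scoped BigOperators Matrix.Norms.L2Operator InnerProductSpace

namespace Summit.QuantumFields.YangMills.Theorems.Prop7SliceBoundOneStepMember

open Literature.MathematicalPhysics.QuantumFieldTheory.Balaban1983to89
open Literature.MathematicalPhysics.QuantumFieldTheory.Balaban1983to89.T3ContinuumYM3Torus
open B7Prop1Explicit (boxVec treeWord)
open B10Eq27TorusAxialLog (transl)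
open T4Continuum BlockAveraging LatticeFieldCalculus
open BlockAveragingEMLLinearised (walkSum linAvg combMean)
open T3SectALandauChart (eta)
open T3LevelShift (siteShift bondShift bondShift_src bondShift_tgt)
open T3PrintedRegularOrbits (sites_eq)
open B11Eq103H1Complex (BondL2K laplaceAK)
open Summit.QuantumFields.YangMills.Theorems.Prop7SectET3Transport (periodsT3)
open Summit.QuantumFields.YangMills.Theorems.Prop7SectET3HilbertLetters (W₂ toL2 toL2B DL2 DstarL2)
open Summit.QuantumFields.YangMills.Theorems.Prop7SectET3GaugeProjector (RS)
open Summit.QuantumFields.YangMills.Theorems.Prop7SectET3WilsonHessian (DeltaEta DeltaEtaSlot)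
open Summit.QuantumFields.YangMills.Theorems.Prop7SectET3CurvedPropagators (Qk)
open Summit.QuantumFields.YangMills.Theorems.Prop7SectET3CombLetters (Qkc)
open Summit.QuantumFields.YangMills.Theorems.Prop7QprimeCombL2 (RcombL2)
open Summit.QuantumFields.YangMills.Theorems.Prop7SPrint (basePt)
open Summit.QuantumFields.YangMills.Theorems.Prop7SymAvgTw (QTw)
open Summit.QuantumFields.YangMills.Theorems.Prop7SymAvgTwSym (QTwS)
open Summit.QuantumFields.YangMills.Theorems.Prop7CmapTwSReadSet (height_le)
open Summit.QuantumFields.YangMills.Theorems.Prop7SliceRowOfFilling (defect_toL2_apply)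
open Summit.QuantumFields.YangMills.Theorems.Prop7SliceRowOfSqBound (sliceBound_basePt_of_sqBound)
open Summit.QuantumFields.YangMills.Theorems.Prop7DefectTelescopeMember (defect_eq_A_add_grad)
open Summit.QuantumFields.YangMills.Theorems.Prop7OneStepL2Bounds (sum_norm_sq_curl_translate)
open Summit.QuantumFields.YangMills.Theorems.Prop7SliceBoundOneStep (sum_norm_sq_entry_le_four_mul l2_opNorm_sq_le_sum_norm_sq_entry sum_norm_sq_defect_le_of_eRow)
open Summit.QuantumFields.YangMills.Theorems.Prop7A6cCertificateOfSliceRow (hN06_at_one_of_sqBound)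
open Summit.QuantumFields.YangMills.Theorems.Prop7OneStepDefectERow (eRow_tower)

variable (F : T3Family) {n K : ℕ} (h : n ≤ K)
set_option maxHeartbeats 400000 in
/-- ★★★ **FILE B′'s `ℓ²` SLICE ROW `hT` FROM THE ONE-STEP DEFECT ROW (E-ROW)**, `A′ := 4·Cdef(L, K_E)∕L^{K−n}`, `Cdef = 8K_E∕(L−2) + 9600L²K_E∕(L−2)²` — K-FREE.  Families `Q G T′ A Φ` by `Nat.rec`
(no family displayed) ∘ px22 ✓`defect_eq_A_add_grad` ∘ w4 ✓`defect_toL2_apply` ∘ px6 ✓`sum_norm_sq_defect_le_of_eRow` ∘ (B6) ∘ the entry∕`L2Operator` comparison.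
[cite: Balaban1985BackgroundPropagators, (3.14) p.393, Thm 3.11 p.416; Balaban1985Averaging, (124)–(127) pp.36–37; Balaban1984PropagatorsI, (1.18) p.20] -/
theorem hT_of_eRow {c₀ cB : ℝ} [Fact (0 < c₀)] [Fact (0 < cB)] {K_E : ℝ} (hKE : 0 ≤ K_E)
    (hE : ∀ (j : ℕ), j < K - n → ∀ (Y : PBond (F.P K) j → Matrix (Fin 2) (Fin 2) ℂ) (e : PBond (F.P K) (j + 1) → Matrix (Fin 2) (Fin 2) ℂ),
      (∀ c : PBond (F.P K) (j + 1), e c = linAvg Y c - ( ((((F.P K).L : ℝ)) ^ (F.P K).d)⁻¹ • ∑ r : Fin (F.P K).d → Fin (F.P K).L, segSum (Y) (transl (emb c.src) (boxVec (F.P K).L r)) c.dir (F.P K).L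
              - ( ((((F.P K).L : ℝ)) ^ (F.P K).d)⁻¹ • ∑ r : Fin (F.P K).d → Fin (F.P K).L, walkSum (Y) (walk (emb c.tgt) (treeWord (boxVec (F.P K).L r)))
                  - ((((F.P K).L : ℝ)) ^ (F.P K).d)⁻¹ • ∑ r : Fin (F.P K).d → Fin (F.P K).L, walkSum (Y) (walk (emb c.src) (treeWord (boxVec (F.P K).L r))) ) )) →
      ∑ c : PBond (F.P K) (j + 1), ‖e c‖ ^ 2 ≤ K_E * ∑ p : Plaq (F.P K) j, ‖curl 1 Y p‖ ^ 2)
    (X : PBond (F.P K) 0 → Matrix (Fin 2) (Fin 2) ℂ) :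
    ∑ c : PBond (F.P n) 0, ∑ i, ∑ i',
        ‖(toL2B F n cB).symm
            (Qkc F n K h c₀ cB (1 : GaugeField (F.P K) 0 (Matrix.specialUnitaryGroup (Fin 2) ℂ)) (toL2 F K c₀ (fun b => X (b.translate (-basePt F n K))))
              - Qk F n K h c₀ cB (1 : GaugeField (F.P K) 0 (Matrix.specialUnitaryGroup (Fin 2) ℂ)) (toL2 F K c₀ X)) c i i'‖ ^ 2
      ≤ (4 * (8 * K_E / ((F.L : ℝ) - 2) + 9600 * (F.L : ℝ) ^ 2 * K_E / ((F.L : ℝ) - 2) ^ 2) / (F.L : ℝ) ^ (K - n))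
          * ∑ p : Plaq (F.P K) 0, ∑ i, ∑ i', ‖curl 1 X p i i'‖ ^ 2 := by
  -- the five PLAN B families on the member's tower, by `Nat.rec`
  let Q : (i : ℕ) → (PBond (F.P K) 0 → Matrix (Fin 2) (Fin 2) ℂ) → PBond (F.P K) i → Matrix (Fin 2) (Fin 2) ℂ := fun i =>
    Nat.rec (motive := fun i => (PBond (F.P K) 0 → Matrix (Fin 2) (Fin 2) ℂ) → PBond (F.P K) i → Matrix (Fin 2) (Fin 2) ℂ) (fun Y => Y) (fun i Qi Y c => linAvg (Qi Y) c) i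
  have hQ0 : ∀ Y, Q 0 Y = Y := fun _ => rfl
  have hQs : ∀ (i : ℕ) (Y : PBond (F.P K) 0 → Matrix (Fin 2) (Fin 2) ℂ) (c : PBond (F.P K) (i + 1)), Q (i + 1) Y c = linAvg (Q i Y) c := fun _ _ _ => rfl
  let G : (j : ℕ) → (PBond (F.P K) 0 → Matrix (Fin 2) (Fin 2) ℂ) → PBond (F.P K) j → Matrix (Fin 2) (Fin 2) ℂ := fun j =>
    Nat.rec (motive := fun j => (PBond (F.P K) 0 → Matrix (Fin 2) (Fin 2) ℂ) → PBond (F.P K) j → Matrix (Fin 2) (Fin 2) ℂ) (fun x => x)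
      (fun j Gj x c => ((((F.P K).L : ℝ)) ^ (F.P K).d)⁻¹ • ∑ r : Fin (F.P K).d → Fin (F.P K).L, segSum (Gj x) (transl (emb c.src) (boxVec (F.P K).L r)) c.dir (F.P K).L
              - ( ((((F.P K).L : ℝ)) ^ (F.P K).d)⁻¹ • ∑ r : Fin (F.P K).d → Fin (F.P K).L, walkSum (Gj x) (walk (emb c.tgt) (treeWord (boxVec (F.P K).L r)))
                  - ((((F.P K).L : ℝ)) ^ (F.P K).d)⁻¹ • ∑ r : Fin (F.P K).d → Fin (F.P K).L, walkSum (Gj x) (walk (emb c.src) (treeWord (boxVec (F.P K).L r))) )) j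
  have hG0 : ∀ x, G 0 x = x := fun _ => rfl
  have hGs : ∀ (j : ℕ) (x : PBond (F.P K) 0 → Matrix (Fin 2) (Fin 2) ℂ) (c : PBond (F.P K) (j + 1)),
      G (j + 1) x c = ((((F.P K).L : ℝ)) ^ (F.P K).d)⁻¹ • ∑ r : Fin (F.P K).d → Fin (F.P K).L, segSum (G j x) (transl (emb c.src) (boxVec (F.P K).L r)) c.dir (F.P K).L
              - ( ((((F.P K).L : ℝ)) ^ (F.P K).d)⁻¹ • ∑ r : Fin (F.P K).d → Fin (F.P K).L, walkSum (G j x) (walk (emb c.tgt) (treeWord (boxVec (F.P K).L r)))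
                  - ((((F.P K).L : ℝ)) ^ (F.P K).d)⁻¹ • ∑ r : Fin (F.P K).d → Fin (F.P K).L, walkSum (G j x) (walk (emb c.src) (treeWord (boxVec (F.P K).L r))) ) := fun _ _ _ => rfl
  let T' : (j : ℕ) → (PBond (F.P K) 0 → Matrix (Fin 2) (Fin 2) ℂ) → PBond (F.P K) j → Matrix (Fin 2) (Fin 2) ℂ := fun j =>
    Nat.rec (motive := fun j => (PBond (F.P K) 0 → Matrix (Fin 2) (Fin 2) ℂ) → PBond (F.P K) j → Matrix (Fin 2) (Fin 2) ℂ) (fun x => x)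
      (fun j Tj x c => (((((F.P K).L : ℝ)) ^ (F.P K).d)⁻¹) • ∑ r : Fin (F.P K).d → Fin (F.P K).L, segSum (Tj x) (transl (emb c.src) (boxVec (F.P K).L r)) c.dir (F.P K).L) j
  have hT0 : ∀ x, T' 0 x = x := fun _ => rfl
  have hTs : ∀ (j : ℕ) (x : PBond (F.P K) 0 → Matrix (Fin 2) (Fin 2) ℂ) (c : PBond (F.P K) (j + 1)),
      T' (j + 1) x c = (((((F.P K).L : ℝ)) ^ (F.P K).d)⁻¹) • ∑ r : Fin (F.P K).d → Fin (F.P K).L, segSum (T' j x) (transl (emb c.src) (boxVec (F.P K).L r)) c.dir (F.P K).L := fun _ _ _ => rfl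
  let A : (j : ℕ) → (PBond (F.P K) 0 → Matrix (Fin 2) (Fin 2) ℂ) → PBond (F.P K) j → Matrix (Fin 2) (Fin 2) ℂ := fun j =>
    Nat.rec (motive := fun j => (PBond (F.P K) 0 → Matrix (Fin 2) (Fin 2) ℂ) → PBond (F.P K) j → Matrix (Fin 2) (Fin 2) ℂ) (fun _ _ => 0)
      (fun j Aj x c => (((F.P K).L : ℕ) : ℂ) • bondAvg (Aj x) c
        + (linAvg (T' j x) c
          - ( ((((F.P K).L : ℝ)) ^ (F.P K).d)⁻¹ • ∑ r : Fin (F.P K).d → Fin (F.P K).L, segSum (T' j x) (transl (emb c.src) (boxVec (F.P K).L r)) c.dir (F.P K).L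
              - ( ((((F.P K).L : ℝ)) ^ (F.P K).d)⁻¹ • ∑ r : Fin (F.P K).d → Fin (F.P K).L, walkSum (T' j x) (walk (emb c.tgt) (treeWord (boxVec (F.P K).L r)))
                  - ((((F.P K).L : ℝ)) ^ (F.P K).d)⁻¹ • ∑ r : Fin (F.P K).d → Fin (F.P K).L, walkSum (T' j x) (walk (emb c.src) (treeWord (boxVec (F.P K).L r))) ) ))) j
  have hA0 : ∀ x b, A 0 x b = 0 := fun _ _ => rfl
  have hAs : ∀ (j : ℕ) (x : PBond (F.P K) 0 → Matrix (Fin 2) (Fin 2) ℂ) (c : PBond (F.P K) (j + 1)),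
      A (j + 1) x c = (((F.P K).L : ℕ) : ℂ) • bondAvg (A j x) c
        + (linAvg (T' j x) c
          - ( ((((F.P K).L : ℝ)) ^ (F.P K).d)⁻¹ • ∑ r : Fin (F.P K).d → Fin (F.P K).L, segSum (T' j x) (transl (emb c.src) (boxVec (F.P K).L r)) c.dir (F.P K).L
              - ( ((((F.P K).L : ℝ)) ^ (F.P K).d)⁻¹ • ∑ r : Fin (F.P K).d → Fin (F.P K).L, walkSum (T' j x) (walk (emb c.tgt) (treeWord (boxVec (F.P K).L r)))
                  - ((((F.P K).L : ℝ)) ^ (F.P K).d)⁻¹ • ∑ r : Fin (F.P K).d → Fin (F.P K).L, walkSum (T' j x) (walk (emb c.src) (treeWord (boxVec (F.P K).L r))) ) )) := fun _ _ _ => rfl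
  let Φ : (j : ℕ) → (PBond (F.P K) 0 → Matrix (Fin 2) (Fin 2) ℂ) → Site (F.P K) j → Matrix (Fin 2) (Fin 2) ℂ := fun j =>
    Nat.rec (motive := fun j => (PBond (F.P K) 0 → Matrix (Fin 2) (Fin 2) ℂ) → Site (F.P K) j → Matrix (Fin 2) (Fin 2) ℂ) (fun _ _ => 0)
      (fun j Φj x y => Φj x (emb y) - combMean (A j x) y) j
  have hΦ0 : ∀ x y, Φ 0 x y = 0 := fun _ _ => rfl
  have hΦs : ∀ (j : ℕ) (x : PBond (F.P K) 0 → Matrix (Fin 2) (Fin 2) ℂ) (y : Site (F.P K) (j + 1)), Φ (j + 1) x y = Φ j x (emb y) - combMean (A j x) y := fun _ _ _ => rfl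
  -- letters
  set X' : PBond (F.P K) 0 → Matrix (Fin 2) (Fin 2) ℂ := fun b => X (b.translate (-basePt F n K)) with hX'
  set k := K - n with hkdef
  let D : PBond (F.P K) k → Matrix (Fin 2) (Fin 2) ℂ := fun c' => A k X' c' + (Φ k X' c'.tgt - Φ k X' c'.src)
  set L : ℝ := (F.L : ℝ) with hLdef
  have hLeq : ((F.P K).L : ℝ) = L := by rw [hLdef]; rfl
  have hL3n : 3 ≤ (F.P K).L := by
    show 3 ≤ F.L
    obtain ⟨⟨m, hm⟩, h1⟩ := F.hL
    omega
  have hL3 : (3 : ℝ) ≤ L := by rw [← hLeq]; exact_mod_cast hL3n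
  have hL0 : 0 < L := by linarith
  -- (1) px22's identity, per coarse bond
  have hdef : ∀ c : PBond (F.P n) 0, QTw F n K h 1 X' c - QTwS F n K h 1 X c = D (bondShift (sites_eq F n K h) c) :=
    fun c => defect_eq_A_add_grad F h Q hQ0 hQs G hG0 hGs T' hT0 hTs A hA0 hAs Φ hΦ0 hΦs X c
  -- (2) px6's recursion bound on the member's tower (`d = 3`, `L ≥ 3`, `k ≤ m + K`)
  set Cdef : ℝ := 8 * K_E / (L - 2) + 9600 * L ^ 2 * K_E / (L - 2) ^ 2 with hCdef
  have hrec : ∑ c : PBond (F.P K) k, ‖D c‖ ^ 2 ≤ Cdef * L ^ k * ∑ p : Plaq (F.P K) 0, ‖curl 1 X' p‖ ^ 2 := by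
    have hr := sum_norm_sq_defect_le_of_eRow (F.P K) (T3Family.P_d F K) hL3n (k := k) (height_le (F := F) (n := n) (K := K))
      T' hT0 hTs A hA0 hAs Φ hΦ0 hΦs hKE hE X'
    rw [hLeq] at hr
    exact hr
  -- (3) the carrier reading: `toL2B⁻¹(Qkc 1 (toL2 X′) − Qk 1 (toL2 X)) c = η • (QTw 1 X′ c − QTwS 1 X c)`
  have hη : (eta F n K : ℝ) = (L ^ k)⁻¹ := by rw [eta, hkdef, hLdef, inv_pow]
  have hη0 : 0 ≤ (eta F n K : ℝ) := by rw [hη]; positivity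
  have hcar : ∀ (c : PBond (F.P n) 0) (i i' : Fin 2),
      ‖(toL2B F n cB).symm
            (Qkc F n K h c₀ cB (1 : GaugeField (F.P K) 0 (Matrix.specialUnitaryGroup (Fin 2) ℂ)) (toL2 F K c₀ X')
              - Qk F n K h c₀ cB (1 : GaugeField (F.P K) 0 (Matrix.specialUnitaryGroup (Fin 2) ℂ)) (toL2 F K c₀ X)) c i i'‖ ^ 2
        = (eta F n K : ℝ) ^ 2 * ‖(D (bondShift (sites_eq F n K h) c)) i i'‖ ^ 2 := by
    intro c i i'
    rw [defect_toL2_apply (h := h) X' X c, hdef c, Matrix.smul_apply, smul_eq_mul, norm_mul, Complex.norm_real, Real.norm_eq_abs, abs_of_nonneg hη0, mul_pow]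
  -- (4) entries ≤ 4·operator norm; reindex by `bondShift`
  have h4 : ∑ c : PBond (F.P n) 0, ∑ i, ∑ i',
      ‖(toL2B F n cB).symm
            (Qkc F n K h c₀ cB (1 : GaugeField (F.P K) 0 (Matrix.specialUnitaryGroup (Fin 2) ℂ)) (toL2 F K c₀ X')
              - Qk F n K h c₀ cB (1 : GaugeField (F.P K) 0 (Matrix.specialUnitaryGroup (Fin 2) ℂ)) (toL2 F K c₀ X)) c i i'‖ ^ 2
      ≤ (eta F n K : ℝ) ^ 2 * (4 * ∑ c' : PBond (F.P K) k, ‖D c'‖ ^ 2) := by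
    simp only [hcar]
    simp only [← Finset.mul_sum]
    refine mul_le_mul_of_nonneg_left ?_ (by positivity)
    calc ∑ c : PBond (F.P n) 0, ∑ i, ∑ i', ‖D (bondShift (sites_eq F n K h) c) i i'‖ ^ 2
        ≤ ∑ c : PBond (F.P n) 0, 4 * ‖D (bondShift (sites_eq F n K h) c)‖ ^ 2 :=
          Finset.sum_le_sum fun c _ => sum_norm_sq_entry_le_four_mul _
      _ = 4 * ∑ c : PBond (F.P n) 0, ‖D (bondShift (sites_eq F n K h) c)‖ ^ 2 := by rw [Finset.mul_sum]
      _ = 4 * ∑ c' : PBond (F.P K) k, ‖D c'‖ ^ 2 := by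
          congr 1
          exact Fintype.sum_equiv (bondShift (sites_eq F n K h)) _ _ fun c => rfl
  -- (5) assemble: recursion bound, translate, entries
  have h6 : ∑ p : Plaq (F.P K) 0, ‖curl 1 X' p‖ ^ 2 = ∑ p : Plaq (F.P K) 0, ‖curl 1 X p‖ ^ 2 :=
    sum_norm_sq_curl_translate (-basePt F n K) X
  have h7 : ∑ p : Plaq (F.P K) 0, ‖curl 1 X p‖ ^ 2 ≤ ∑ p : Plaq (F.P K) 0, ∑ i, ∑ i', ‖curl 1 X p i i'‖ ^ 2 :=
    Finset.sum_le_sum fun p _ => l2_opNorm_sq_le_sum_norm_sq_entry _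
  have hL2 : 0 < L - 2 := by linarith
  have hCdef0 : 0 ≤ Cdef := by rw [hCdef]; positivity
  have hLk : 0 < L ^ k := pow_pos hL0 k
  have hS0 : 0 ≤ ∑ p : Plaq (F.P K) 0, ‖curl 1 X p‖ ^ 2 := Finset.sum_nonneg fun p _ => by positivity
  calc ∑ c : PBond (F.P n) 0, ∑ i, ∑ i',
        ‖(toL2B F n cB).symm
            (Qkc F n K h c₀ cB (1 : GaugeField (F.P K) 0 (Matrix.specialUnitaryGroup (Fin 2) ℂ)) (toL2 F K c₀ X')
              - Qk F n K h c₀ cB (1 : GaugeField (F.P K) 0 (Matrix.specialUnitaryGroup (Fin 2) ℂ)) (toL2 F K c₀ X)) c i i'‖ ^ 2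
      ≤ (eta F n K : ℝ) ^ 2 * (4 * ∑ c' : PBond (F.P K) k, ‖D c'‖ ^ 2) := h4
    _ ≤ (eta F n K : ℝ) ^ 2 * (4 * (Cdef * L ^ k * ∑ p : Plaq (F.P K) 0, ‖curl 1 X' p‖ ^ 2)) :=
        mul_le_mul_of_nonneg_left (mul_le_mul_of_nonneg_left hrec (by norm_num)) (sq_nonneg _)
    _ = (4 * Cdef / L ^ k) * ∑ p : Plaq (F.P K) 0, ‖curl 1 X p‖ ^ 2 := by
        rw [h6, hη]; field_simp
    _ ≤ (4 * Cdef / L ^ k) * ∑ p : Plaq (F.P K) 0, ∑ i, ∑ i', ‖curl 1 X p i i'‖ ^ 2 :=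
        mul_le_mul_of_nonneg_left h7 (by positivity)

/-- ★★★ **THE A6ᶜ CERTIFICATE MODULO THE E-ROW ALONE**: S27ᴸ∕S31ᴸ `hN06`'s conclusion AT THE MEMBER `W := 1` — `∃ G₀, laplaceAK (DeltaEtaSlot 1) (DL2 1) (RcombL2 1) (DstarL2 1) (Qkc 1) (Qkc 1)† ↑(a₀(c₀∕cB)ℓ³) ∘ₗ G₀ = id ∧
∀ f, ‖G₀ f‖ ≤ 4·Cst 3 a₀·(2 + 2·(a₀·A′·ℓ))·‖f‖` with `A′·ℓ = 4·Cdef(L, K_E)` K-FREE — from the one-step defect row (E-ROW) by `hT_of_eRow` ∘ px6 ✓`hN06_at_one_of_sqBound`.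
[cite: Balaban1985BackgroundPropagators, Thm 3.3 p.399, Thm 3.11 p.416, (3.27) p.395; Balaban1984PropagatorsI, Prop. 1.1 (1.90) p.33] -/
theorem hN06_at_one_of_eRow (hnK : n < K) {c₀ cB : ℝ} [Fact (0 < c₀)] [Fact (0 < cB)] {a₀ : ℝ} (ha₀ : 0 < a₀) {K_E : ℝ} (hKE : 0 ≤ K_E)
    (hE : ∀ (j : ℕ), j < K - n → ∀ (Y : PBond (F.P K) j → Matrix (Fin 2) (Fin 2) ℂ) (e : PBond (F.P K) (j + 1) → Matrix (Fin 2) (Fin 2) ℂ),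
      (∀ c : PBond (F.P K) (j + 1), e c = linAvg Y c - ( ((((F.P K).L : ℝ)) ^ (F.P K).d)⁻¹ • ∑ r : Fin (F.P K).d → Fin (F.P K).L, segSum (Y) (transl (emb c.src) (boxVec (F.P K).L r)) c.dir (F.P K).L
              - ( ((((F.P K).L : ℝ)) ^ (F.P K).d)⁻¹ • ∑ r : Fin (F.P K).d → Fin (F.P K).L, walkSum (Y) (walk (emb c.tgt) (treeWord (boxVec (F.P K).L r)))
                  - ((((F.P K).L : ℝ)) ^ (F.P K).d)⁻¹ • ∑ r : Fin (F.P K).d → Fin (F.P K).L, walkSum (Y) (walk (emb c.src) (treeWord (boxVec (F.P K).L r))) ) )) →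
      ∑ c : PBond (F.P K) (j + 1), ‖e c‖ ^ 2 ≤ K_E * ∑ p : Plaq (F.P K) j, ‖curl 1 Y p‖ ^ 2) :
    ∃ G₀ : BondL2K ℂ 3 (periodsT3 F K) c₀ W₂ →ₗ[ℂ] BondL2K ℂ 3 (periodsT3 F K) c₀ W₂,
      laplaceAK (DeltaEtaSlot F n K c₀ 1) (DL2 F n K c₀ 1) (RcombL2 F n K c₀ 1) (DstarL2 F n K c₀ 1)
          (Qkc F n K hnK.le c₀ cB 1) (LinearMap.adjoint (Qkc F n K hnK.le c₀ cB 1))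
          (((a₀ * (c₀ / cB) * ((F.L : ℝ) ^ (K - n)) ^ 3 : ℝ) : ℂ)) ∘ₗ G₀ = LinearMap.id ∧
      ∀ f, ‖G₀ f‖ ≤ 4 * B5Prop11Plancherel.Cst 3 a₀
        * (2 + 2 * (a₀ * (4 * (8 * K_E / ((F.L : ℝ) - 2) + 9600 * (F.L : ℝ) ^ 2 * K_E / ((F.L : ℝ) - 2) ^ 2) / (F.L : ℝ) ^ (K - n)) * (F.L : ℝ) ^ (K - n))) * ‖f‖ := by
  have hL3 : (3 : ℝ) ≤ F.L := by
    obtain ⟨⟨m, hm⟩, h1⟩ := F.hL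
    exact_mod_cast (show 3 ≤ F.L by omega)
  have hL2 : 0 < (F.L : ℝ) - 2 := by linarith
  have hA' : 0 ≤ 4 * (8 * K_E / ((F.L : ℝ) - 2) + 9600 * (F.L : ℝ) ^ 2 * K_E / ((F.L : ℝ) - 2) ^ 2) / (F.L : ℝ) ^ (K - n) := by positivity
  exact hN06_at_one_of_sqBound hnK ha₀ hA' (hT_of_eRow F hnK.le hKE hE)

/-! ## ★★★ UNCONDITIONAL: with px6's P4-D ✓`eRow_tower` the E-ROW is a theorem — `hT`, (I3′) and the A6ᶜ certificate hold with NO displayed row -/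

/-- The E-ROW constant of P4-D at the member's tower (`d = 3`: `((18L)·(3·(2L + (L−1)∕2)))²·81`). -/
theorem eRowConst_nonneg : (0 : ℝ) ≤ (((((4 * (F.P K).d + 6) * (F.P K).L : ℕ) : ℝ) * (((F.P K).d : ℝ) * ((2 * (F.P K).L + ((F.P K).L - 1) / 2 : ℕ) : ℝ))) ^ 2 * (((F.P K).d * 3 ^ (F.P K).d : ℕ) : ℝ)) := by positivity

/-- The tower height `K − n` leaves one level of room: `K − n + 1 ≤ (F.P K).m + (F.P K).K = F.m + K` (`F.m ≥ 1`). [cite: Balaban1985UV3, (1)-(3) p.256] -/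
theorem height_succ_le : K - n + 1 ≤ (F.P K).m + (F.P K).K := by
  show K - n + 1 ≤ F.m + K
  have := F.hm
  omega

/-- ★★★ **FILE B′'s `ℓ²` SLICE ROW `hT` HOLDS — NO DISPLAYED ROW** (`A′ = 4·Cdef(L, K_E(L))∕L^{K−n}`, `K_E(L) = ((18L)·(3(2L+(L−1)∕2)))²·81`): `hT_of_eRow` ∘ px6 ✓`Prop7OneStepDefectERow.eRow_tower`
(w4's P1 ∘ px21's P2 support row ∘ the box-owner count).  Feeds w4 ✓`sliceBound_basePt_of_sqBound` (px13's (hv), `ρ = 4a₀·Cdef`, K-FREE) and ✓`coercive_laplaceAc_one_of_sqBound` (COMB-FLAT COERCIVITY at the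
flat member, ★★OWNER RULING №17∕№18's open lemma). [cite: Balaban1985BackgroundPropagators, (3.14) p.393, Thm 3.11 p.416; Balaban1985Averaging, (124)–(127) pp.36–37; Balaban1984PropagatorsI, (1.9) p.19, (1.18) p.20] -/
theorem hT_holds {c₀ cB : ℝ} [Fact (0 < c₀)] [Fact (0 < cB)] (X : PBond (F.P K) 0 → Matrix (Fin 2) (Fin 2) ℂ) :
    ∑ c : PBond (F.P n) 0, ∑ i, ∑ i',
        ‖(toL2B F n cB).symm
            (Qkc F n K h c₀ cB (1 : GaugeField (F.P K) 0 (Matrix.specialUnitaryGroup (Fin 2) ℂ)) (toL2 F K c₀ (fun b => X (b.translate (-basePt F n K))))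
              - Qk F n K h c₀ cB (1 : GaugeField (F.P K) 0 (Matrix.specialUnitaryGroup (Fin 2) ℂ)) (toL2 F K c₀ X)) c i i'‖ ^ 2
      ≤ (4 * (8 * (((((4 * (F.P K).d + 6) * (F.P K).L : ℕ) : ℝ) * (((F.P K).d : ℝ) * ((2 * (F.P K).L + ((F.P K).L - 1) / 2 : ℕ) : ℝ))) ^ 2 * (((F.P K).d * 3 ^ (F.P K).d : ℕ) : ℝ)) / ((F.L : ℝ) - 2) + 9600 * (F.L : ℝ) ^ 2 * (((((4 * (F.P K).d + 6) * (F.P K).L : ℕ) : ℝ) * (((F.P K).d : ℝ) * ((2 * (F.P K).L + ((F.P K).L - 1) / 2 : ℕ) : ℝ))) ^ 2 * (((F.P K).d * 3 ^ (F.P K).d : ℕ) : ℝ)) / ((F.L : ℝ) - 2) ^ 2) / (F.L : ℝ) ^ (K - n))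
          * ∑ p : Plaq (F.P K) 0, ∑ i, ∑ i', ‖curl 1 X p i i'‖ ^ 2 :=
  hT_of_eRow F h (eRowConst_nonneg F) (eRow_tower (P := F.P K) (height_succ_le F (n := n) (K := K))) X

/-- ★★★ **THE A6ᶜ CERTIFICATE — CLOSED BY KERNEL, NO DISPLAYED ROW**: the (N06)ᶜ row `hN06` of the EX display (S27ᴸ…S31ᴸ) IS INHABITED AT THE FLAT MEMBER `W := 1`, for every `K`, `n < K`, `L`:
`∃ G₀, laplaceAK (DeltaEtaSlot 1) (DL2 1) (RcombL2 1) (DstarL2 1) (Qkc 1) (Qkc 1)† ↑(a₀(c₀∕cB)ℓ³) ∘ₗ G₀ = id ∧ ∀ f, ‖G₀ f‖ ≤ 4·Cst 3 a₀·(2 + 2·(a₀·A′·ℓ))·‖f‖` with `A′·ℓ = 4·Cdef(L, K_E(L))` — an L-ONLY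
constant (★★OWNER RULING g28-№13 (c2)(c3), №17 (3), №18 (2): certificate A6ᶜ).  `hN06_at_one_of_eRow` ∘ ✓`eRow_tower`; by lit ✓`regPr_one` the member `1` lies in every `RegPr F n K e`, so hypothesis range and
conclusion of `hN06` are inhabited together.  `hN06` at CURVED `W` (N06 = [B9] Thm 3.3∕3.11 proper) is NOT touched.
[cite: Balaban1985BackgroundPropagators, Thm 3.3 p.399, Thm 3.11 p.416, (3.27) p.395; Balaban1984PropagatorsI, Prop. 1.1 (1.90) p.33; Balaban1985RegularSpaces, p.98] -/
theorem hN06_at_one (hnK : n < K) {c₀ cB : ℝ} [Fact (0 < c₀)] [Fact (0 < cB)] {a₀ : ℝ} (ha₀ : 0 < a₀) :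
    ∃ G₀ : BondL2K ℂ 3 (periodsT3 F K) c₀ W₂ →ₗ[ℂ] BondL2K ℂ 3 (periodsT3 F K) c₀ W₂,
      laplaceAK (DeltaEtaSlot F n K c₀ 1) (DL2 F n K c₀ 1) (RcombL2 F n K c₀ 1) (DstarL2 F n K c₀ 1)
          (Qkc F n K hnK.le c₀ cB 1) (LinearMap.adjoint (Qkc F n K hnK.le c₀ cB 1))
          (((a₀ * (c₀ / cB) * ((F.L : ℝ) ^ (K - n)) ^ 3 : ℝ) : ℂ)) ∘ₗ G₀ = LinearMap.id ∧
      ∀ f, ‖G₀ f‖ ≤ 4 * B5Prop11Plancherel.Cst 3 a₀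
        * (2 + 2 * (a₀ * (4 * (8 * (((((4 * (F.P K).d + 6) * (F.P K).L : ℕ) : ℝ) * (((F.P K).d : ℝ) * ((2 * (F.P K).L + ((F.P K).L - 1) / 2 : ℕ) : ℝ))) ^ 2 * (((F.P K).d * 3 ^ (F.P K).d : ℕ) : ℝ)) / ((F.L : ℝ) - 2) + 9600 * (F.L : ℝ) ^ 2 * (((((4 * (F.P K).d + 6) * (F.P K).L : ℕ) : ℝ) * (((F.P K).d : ℝ) * ((2 * (F.P K).L + ((F.P K).L - 1) / 2 : ℕ) : ℝ))) ^ 2 * (((F.P K).d * 3 ^ (F.P K).d : ℕ) : ℝ)) / ((F.L : ℝ) - 2) ^ 2) / (F.L : ℝ) ^ (K - n)) * (F.L : ℝ) ^ (K - n))) * ‖f‖ :=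
  hN06_at_one_of_eRow F hnK ha₀ (eRowConst_nonneg F) (eRow_tower (P := F.P K) (height_succ_le F (n := n) (K := K)))

/-! ## L-ONLY LETTERS — the constants in the letter `F.L` ALONE, and the c2-shapes `∀ L, ∃ C, ∀ F, F.L = L → ∀ n K …` (★★OWNER RULING №23 (a): independence of `K`, `n`
and the member made KERNEL-VISIBLE by the binder order; w4 g9's reading remark on the `B₀` numeral) -/

/-- The E-ROW constant `K_E` at the member (`d = 3`, `(F.P K).L = F.L`) in the letter `F.L` alone: `((18L)·(3·(2L + (L−1)∕2)))²·81`. -/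
theorem eRowConst_eq : (((((4 * (F.P K).d + 6) * (F.P K).L : ℕ) : ℝ) * (((F.P K).d : ℝ) * ((2 * (F.P K).L + ((F.P K).L - 1) / 2 : ℕ) : ℝ))) ^ 2 * (((F.P K).d * 3 ^ (F.P K).d : ℕ) : ℝ))
    = ((((18 * F.L : ℕ) : ℝ) * ((3 : ℝ) * ((2 * F.L + (F.L - 1) / 2 : ℕ) : ℝ))) ^ 2 * 81) := by
  rw [T3Family.P_d F K]
  have hPL : (F.P K).L = F.L := rfl
  rw [hPL]
  push_cast
  ring

/-- ★★★ **FILE B′'s `hT` — NO HYPOTHESIS, CONSTANT IN `F.L` ALONE**: `A′ = A₃(F.L) ∕ (F.L)^(K−n)`, `A₃(L) = 4·(8K_E(L)∕(L−2) + 9600L²K_E(L)∕(L−2)²)`, `K_E(L) = ((18L)·(3·(2L+(L−1)∕2)))²·81`.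
[cite: Balaban1985BackgroundPropagators, (3.14) p.393, Thm 3.11 p.416; Balaban1985Averaging, (124)–(127) pp.36–37; Balaban1984PropagatorsI, (1.18) p.20] -/
theorem hT_holds_L {c₀ cB : ℝ} [Fact (0 < c₀)] [Fact (0 < cB)] (X : PBond (F.P K) 0 → Matrix (Fin 2) (Fin 2) ℂ) :
    ∑ c : PBond (F.P n) 0, ∑ i, ∑ i',
        ‖(toL2B F n cB).symm
            (Qkc F n K h c₀ cB (1 : GaugeField (F.P K) 0 (Matrix.specialUnitaryGroup (Fin 2) ℂ)) (toL2 F K c₀ (fun b => X (b.translate (-basePt F n K))))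
              - Qk F n K h c₀ cB (1 : GaugeField (F.P K) 0 (Matrix.specialUnitaryGroup (Fin 2) ℂ)) (toL2 F K c₀ X)) c i i'‖ ^ 2
      ≤ (4 * (8 * ((((18 * F.L : ℕ) : ℝ) * ((3 : ℝ) * ((2 * F.L + (F.L - 1) / 2 : ℕ) : ℝ))) ^ 2 * 81) / ((F.L : ℝ) - 2) + 9600 * (F.L : ℝ) ^ 2 * ((((18 * F.L : ℕ) : ℝ) * ((3 : ℝ) * ((2 * F.L + (F.L - 1) / 2 : ℕ) : ℝ))) ^ 2 * 81) / ((F.L : ℝ) - 2) ^ 2) / (F.L : ℝ) ^ (K - n))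
          * ∑ p : Plaq (F.P K) 0, ∑ i, ∑ i', ‖curl 1 X p i i'‖ ^ 2 := by
  rw [← eRowConst_eq F (K := K)]
  exact hT_holds F h X

/-- ★★★ **THE A6ᶜ CERTIFICATE WITH AN `F.L`-ONLY `B₀`** (the `ℓ∕ℓ` cancelled, `d = 3` substituted): `‖G₀ f‖ ≤ 4·Cst 3 a₀·(2 + 2·a₀·A₃(F.L))·‖f‖`.
[cite: Balaban1985BackgroundPropagators, Thm 3.3 p.399, Thm 3.11 p.416; Balaban1984PropagatorsI, Prop. 1.1 (1.90) p.33] -/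
theorem hN06_at_one_L (hnK : n < K) {c₀ cB : ℝ} [Fact (0 < c₀)] [Fact (0 < cB)] {a₀ : ℝ} (ha₀ : 0 < a₀) :
    ∃ G₀ : BondL2K ℂ 3 (periodsT3 F K) c₀ W₂ →ₗ[ℂ] BondL2K ℂ 3 (periodsT3 F K) c₀ W₂,
      laplaceAK (DeltaEtaSlot F n K c₀ 1) (DL2 F n K c₀ 1) (RcombL2 F n K c₀ 1) (DstarL2 F n K c₀ 1)
          (Qkc F n K hnK.le c₀ cB 1) (LinearMap.adjoint (Qkc F n K hnK.le c₀ cB 1))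
          (((a₀ * (c₀ / cB) * ((F.L : ℝ) ^ (K - n)) ^ 3 : ℝ) : ℂ)) ∘ₗ G₀ = LinearMap.id ∧
      ∀ f, ‖G₀ f‖ ≤ 4 * B5Prop11Plancherel.Cst 3 a₀ * (2 + 2 * (a₀ * (4 * (8 * ((((18 * F.L : ℕ) : ℝ) * ((3 : ℝ) * ((2 * F.L + (F.L - 1) / 2 : ℕ) : ℝ))) ^ 2 * 81) / ((F.L : ℝ) - 2) + 9600 * (F.L : ℝ) ^ 2 * ((((18 * F.L : ℕ) : ℝ) * ((3 : ℝ) * ((2 * F.L + (F.L - 1) / 2 : ℕ) : ℝ))) ^ 2 * 81) / ((F.L : ℝ) - 2) ^ 2)))) * ‖f‖ := by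
  obtain ⟨G₀, hG, hB⟩ := hN06_at_one F hnK (c₀ := c₀) (cB := cB) ha₀
  refine ⟨G₀, hG, fun f => ?_⟩
  have hL0 : (0 : ℝ) < F.L := by
    have h1 := F.hL.2
    exact_mod_cast (show 0 < F.L by omega)
  have hℓ : (F.L : ℝ) ^ (K - n) ≠ 0 := pow_ne_zero _ hL0.ne'
  have h1 := hB f
  rw [mul_assoc a₀, div_mul_cancel₀ _ hℓ, eRowConst_eq F (K := K)] at h1
  exact h1

/-- ★★★ **c2-SHAPE OF FILE B′'s `hT`**: `∀ L > 1, ∃ A ≥ 0, ∀ F, F.L = L → ∀ n ≤ K, ∀ c₀ cB X, Σ‖defect‖² ≤ A ∕ (F.L)^(K−n) · Σ‖curl X‖²` — ONE constant `A = A₃(L)` BEFORE the member, `n`, `K` (kernel-visible K-uniformity of the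
`(1∕ℓ)`-slice row). [cite: Balaban1985BackgroundPropagators, (3.14) p.393; Balaban1985Averaging, (124)–(127) pp.36–37] -/
theorem hT_holds_c2 (L : ℕ) (hL : 1 < L) :
    ∃ A : ℝ, 0 ≤ A ∧ ∀ (F : T3Family), F.L = L → ∀ (n K : ℕ) (h : n ≤ K) (c₀ cB : ℝ) [Fact (0 < c₀)] [Fact (0 < cB)]
      (X : PBond (F.P K) 0 → Matrix (Fin 2) (Fin 2) ℂ),
      ∑ c : PBond (F.P n) 0, ∑ i, ∑ i',
        ‖(toL2B F n cB).symm
            (Qkc F n K h c₀ cB (1 : GaugeField (F.P K) 0 (Matrix.specialUnitaryGroup (Fin 2) ℂ)) (toL2 F K c₀ (fun b => X (b.translate (-basePt F n K))))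
              - Qk F n K h c₀ cB (1 : GaugeField (F.P K) 0 (Matrix.specialUnitaryGroup (Fin 2) ℂ)) (toL2 F K c₀ X)) c i i'‖ ^ 2
      ≤ A / (F.L : ℝ) ^ (K - n) * ∑ p : Plaq (F.P K) 0, ∑ i, ∑ i', ‖curl 1 X p i i'‖ ^ 2 := by
  refine ⟨4 * (8 * ((((18 * L : ℕ) : ℝ) * ((3 : ℝ) * ((2 * L + (L - 1) / 2 : ℕ) : ℝ))) ^ 2 * 81) / ((L : ℝ) - 2) + 9600 * (L : ℝ) ^ 2 * ((((18 * L : ℕ) : ℝ) * ((3 : ℝ) * ((2 * L + (L - 1) / 2 : ℕ) : ℝ))) ^ 2 * 81) / ((L : ℝ) - 2) ^ 2), ?_, ?_⟩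
  · have h2 : (0 : ℝ) ≤ (L : ℝ) - 2 := by
      have h2' : (2 : ℝ) ≤ L := by exact_mod_cast hL
      linarith
    have hK : (0 : ℝ) ≤ ((((18 * L : ℕ) : ℝ) * ((3 : ℝ) * ((2 * L + (L - 1) / 2 : ℕ) : ℝ))) ^ 2 * 81) := by positivity
    refine mul_nonneg (by norm_num) (add_nonneg (div_nonneg (by positivity) h2) (div_nonneg (by positivity) (pow_nonneg h2 2)))
  · intro F hF n K h c₀ cB _ _ X
    subst hF
    exact hT_holds_L F h X

/-- ★★★ **c2-SHAPE OF THE A6ᶜ CERTIFICATE**: `∀ L > 1, ∀ a₀ > 0, ∃ B₀ ≥ 0, ∀ F, F.L = L → ∀ n < K, ∀ c₀ cB, ∃ G₀, Δ_aᶜ(W := 1) ∘ G₀ = id ∧ ‖G₀ f‖ ≤ B₀‖f‖` — the displayed (N06)ᶜ row's conclusion at the flat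
member with ONE `B₀ = B₀(L, a₀)` chosen BEFORE the member, `n`, `K`, the weights. [cite: Balaban1985BackgroundPropagators, Thm 3.3 p.399, Thm 3.11 p.416, (3.27) p.395; Balaban1984PropagatorsI, Prop. 1.1 (1.90) p.33] -/
theorem hN06_at_one_c2 (L : ℕ) (hL : 1 < L) {a₀ : ℝ} (ha₀ : 0 < a₀) :
    ∃ B₀ : ℝ, 0 ≤ B₀ ∧ ∀ (F : T3Family), F.L = L → ∀ (n K : ℕ) (hnK : n < K) (c₀ cB : ℝ) [Fact (0 < c₀)] [Fact (0 < cB)],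
      ∃ G₀ : BondL2K ℂ 3 (periodsT3 F K) c₀ W₂ →ₗ[ℂ] BondL2K ℂ 3 (periodsT3 F K) c₀ W₂,
      laplaceAK (DeltaEtaSlot F n K c₀ 1) (DL2 F n K c₀ 1) (RcombL2 F n K c₀ 1) (DstarL2 F n K c₀ 1)
          (Qkc F n K hnK.le c₀ cB 1) (LinearMap.adjoint (Qkc F n K hnK.le c₀ cB 1))
          (((a₀ * (c₀ / cB) * ((F.L : ℝ) ^ (K - n)) ^ 3 : ℝ) : ℂ)) ∘ₗ G₀ = LinearMap.id ∧
      ∀ f, ‖G₀ f‖ ≤ B₀ * ‖f‖ := by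
  refine ⟨4 * B5Prop11Plancherel.Cst 3 a₀ * (2 + 2 * (a₀ * (4 * (8 * ((((18 * L : ℕ) : ℝ) * ((3 : ℝ) * ((2 * L + (L - 1) / 2 : ℕ) : ℝ))) ^ 2 * 81) / ((L : ℝ) - 2) + 9600 * (L : ℝ) ^ 2 * ((((18 * L : ℕ) : ℝ) * ((3 : ℝ) * ((2 * L + (L - 1) / 2 : ℕ) : ℝ))) ^ 2 * 81) / ((L : ℝ) - 2) ^ 2)))), ?_, ?_⟩
  · have hC : 0 < B5Prop11Plancherel.Cst 3 a₀ := B5Prop11Lattice.Cst_pos (d := 3) (a := a₀)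
    have h2 : (0 : ℝ) ≤ (L : ℝ) - 2 := by
      have h2' : (2 : ℝ) ≤ L := by exact_mod_cast hL
      linarith
    have hK : (0 : ℝ) ≤ ((((18 * L : ℕ) : ℝ) * ((3 : ℝ) * ((2 * L + (L - 1) / 2 : ℕ) : ℝ))) ^ 2 * 81) := by positivity
    have hA : (0 : ℝ) ≤ 4 * (8 * ((((18 * L : ℕ) : ℝ) * ((3 : ℝ) * ((2 * L + (L - 1) / 2 : ℕ) : ℝ))) ^ 2 * 81) / ((L : ℝ) - 2) + 9600 * (L : ℝ) ^ 2 * ((((18 * L : ℕ) : ℝ) * ((3 : ℝ) * ((2 * L + (L - 1) / 2 : ℕ) : ℝ))) ^ 2 * 81) / ((L : ℝ) - 2) ^ 2) :=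
      mul_nonneg (by norm_num) (add_nonneg (div_nonneg (by positivity) h2) (div_nonneg (by positivity) (pow_nonneg h2 2)))
    have hA2 : (0 : ℝ) ≤ 2 + 2 * (a₀ * (4 * (8 * ((((18 * L : ℕ) : ℝ) * ((3 : ℝ) * ((2 * L + (L - 1) / 2 : ℕ) : ℝ))) ^ 2 * 81) / ((L : ℝ) - 2) + 9600 * (L : ℝ) ^ 2 * ((((18 * L : ℕ) : ℝ) * ((3 : ℝ) * ((2 * L + (L - 1) / 2 : ℕ) : ℝ))) ^ 2 * 81) / ((L : ℝ) - 2) ^ 2))) := by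
      have := mul_nonneg ha₀.le hA
      linarith
    exact mul_nonneg (mul_nonneg (by norm_num) hC.le) hA2
  · intro F hF n K hnK c₀ cB _ _
    subst hF
    exact hN06_at_one_L F hnK ha₀

end Summit.QuantumFields.YangMills.Theorems.Prop7SliceBoundOneStepMember

end
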